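import Summits.CriticalPhenomena.SAWScalingLimit.Theses.SAWMassiveIsingTilt
import Summits.CriticalPhenomena.SAWScalingLimit.Theorems.SAWMassiveIsingTiltDefs
import Summits.CriticalPhenomena.SAWScalingLimit.Theorems.SAWMassiveIsingTiltMassiveWindowSLEStubHullRestrictionOfDefect
import Summits.CriticalPhenomena.SAWScalingLimit.Theorems.SAWMassiveIsingTiltMassiveWindowSLEStubWindowLSWFamily
import Summits.CriticalPhenomena.SAWScalingLimit.Theorems.SAWMassiveIsingTiltMassiveWindowSLEStubWindowNesting
import Summits.CriticalPhenomena.SAWScalingLimit.Theorems.SAWMassiveIsingTiltMassiveWindowSLEStubWindowRestrictionDefectOfMixing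
import Summits.CriticalPhenomena.SAWScalingLimit.Theorems.SAWMassiveIsingTiltMassiveWindowSLEStubWindowLimitChordal
import Summits.CriticalPhenomena.SAWScalingLimit.Theorems.SAWMassiveIsingTiltMassiveWindowSLEStubZloopRateRatioMixing
import Summits.CriticalPhenomena.SAWScalingLimit.Theorems.SAWMassiveIsingTiltMassiveWindowSLEStubAvoidRestrictionOfDefect
import Summits.CriticalPhenomena.SAWScalingLimit.Theorems.SAWMassiveIsingTiltMassiveWindowSLEStubHullRestrictionOfAvoidRestriction

/-!
# Crux `SAWMassiveIsingTilt.MassiveWindowSLE` (stmt-CriticalPhenomena-7685), line `registered`: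
# the line as ONE tree theorem, and the exact size of its last stub

Skeleton r10 of the line (`Cruxes/MassiveWindowSLE/Lines/birth.lean`) is closed modulo the single
registered stub S1' `stub_covariantSimpleRateWindowLimit`. This file moves that fact from the crux
workfile into the tree:

* `windowRestrictionDefect_of_rateMixing` (R', proved in the skeleton since r7, landed here): nesting +
  RATE-form window ratio mixing of `Zloop` ⇒ the two-sided restriction defect with an `ε`-layer;
* `rateWindowLSWFamily_of_covariantSimpleRateWindowLimit`: the S1' statement (verbatim, as a
  hypothesis) yields, ALONG THE SAME schedule / tilt / rate, a window-limit family with all four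
  Lawler–Schramm–Werner axioms (chordality from `stub_windowLimitChordal` p156761; hull restriction from
  the landed engine `stub_windowNesting` p151799 + `stub_zloopRateRatioMixing` p158223 + R' +
  `stub_avoidRestrictionOfDefect` p161236 + `stub_hullRestrictionOfAvoidRestriction` p161180);
* `covariantSimpleRateWindowLimit_iff_rateWindowLSWFamily`: hence S1' is EQUIVALENT to "the crux's
  window-LSW family exists along some FAST RATE schedule with eventually positive tilt" — the residual
  gap between S1' and the crux (`massiveWindowSLE_iff_windowLSWFamily`, p146711: any schedule with
  `m → ∞`, `mδ·δ → 0`) is exactly the schedule class, nothing else;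
* `massiveWindowSLE_of_covariantSimpleRateWindowLimit`: S1' ⇒ `MassiveWindowSLE` (the composition
  `MassiveWindowSLE_of` of the skeleton with every other stub fed by its landed theorem), so whoever
  proves S1' closes the crux by modus ponens against the tree.

No new definitions; axioms `propext`, `Classical.choice`, `Quot.sound`.
-/

namespace Summit.CriticalPhenomena.SAWScalingLimit.Theorems.MassiveWindowSLE.Birth

open scoped BigOperators Topology Classical MeasureTheory NNReal ENNReal
open Filter Set MeasureTheory
open Literature.Probability Literature.Probability.RandomPlanarGeometry

/-- **R' (reduction, PROVED here): nesting + RATE-form ratio mixing ⇒ the restriction defect** — c2's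
landed `stub_windowRestrictionDefect_of_mixing` with the RATE hypothesis threaded through: the same three
lemmas `wrm_pinned_of_pairwise`, `wrm_defect_of_ratioMixing`, `hrd_isOpen_avoid`. -/
theorem windowRestrictionDefect_of_rateMixing :
    (∀ (D D' : Literature.Probability.RandomPlanarGeometry.DobrushinDomain), D.IsHullSubdomain D' → ∀ (a b : ℝ → Literature.Probability.LatticeModels.HexVertex), Literature.Probability.RandomPlanarGeometry.SAW.IsEmbEndpointApprox Literature.Probability.LatticeModels.hexGraph Literature.Probability.LatticeModels.hexCenter D a b → Literature.Probability.RandomPlanarGeometry.SAW.IsEmbEndpointApprox Literature.Probability.LatticeModels.hexGraph Literature.Probability.LatticeModels.hexCenter D' a b → ∀ ε : ℝ, 0 < ε → ∀ᶠ δ in nhdsWithin 0 (Set.Ioi 0), (∀ γ' : Literature.Probability.RandomPlanarGeometry.SAW.HexDomainSAW D'.carrier δ (a δ) (b δ), ∃ γ : Literature.Probability.RandomPlanarGeometry.SAW.HexDomainSAW D.carrier δ (a δ) (b δ), γ.walk.support = γ'.walk.support) ∧ (∀ γ : Literature.Probability.RandomPlanarGeometry.SAW.HexDomainSAW D.carrier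 δ (a δ) (b δ), γ.curve ∈ {γ : Literature.Probability.RandomPlanarGeometry.CurveClass ℂ | ∀ z ∈ γ.range, ∀ k ∈ closure (D.carrier \ D'.carrier), ε < dist z k} → ∃ γ' : Literature.Probability.RandomPlanarGeometry.SAW.HexDomainSAW D'.carrier δ (a δ) (b δ), γ'.walk.support = γ.walk.support)) → (∀ (m c : ℝ → ℝ), Filter.Tendsto (fun δ => m δ * δ) (nhdsWithin 0 (Set.Ioi 0)) (nhds 0) ∧ Filter.Tendsto (fun δ => m δ / Real.log δ⁻¹) (nhdsWithin 0 (Set.Ioi 0)) Filter.atTop → (Filter.Tendsto (fun δ => c δ / (δ * Real.log δ⁻¹)) (nhdsWithin 0 (Set.Ioi 0)) Filter.atTop ∧ ∀ᶠ δ in nhdsWithin 0 (Set.Ioi 0), ∀ (Λ : Finset Literature.Probability.LatticeModels.HexVertex) (u v : Literature.Probability.LatticeModels.HexVertex), u ∈ Λ → v ∈ Λ → u ≠ v → (∑ᶠ E ∈ {E : Finset (Sym2 Literature.Probability.LatticeModels.HexVertex) | (∀ e ∈ E, e ∈ (Literature.Probability.LatticeModels.hexGraph).edgeSet ∧ ∀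 w ∈ e, w ∈ (↑Λ : Set Literature.Probability.LatticeModels.HexVertex)) ∧ ∀ w : Literature.Probability.LatticeModels.HexVertex, (Odd (E.filter (fun e => w ∈ e)).card ↔ (w = u ∨ w = v))}, ((Real.sqrt 3)⁻¹ - m δ * δ) ^ E.card) ≤ Real.exp (-(c δ * dist (Literature.Probability.LatticeModels.hexCenter u) (Literature.Probability.LatticeModels.hexCenter v))) * Summit.CriticalPhenomena.SAWScalingLimit.Theorems.SAWMassiveIsingTilt.Zloop Literature.Probability.LatticeModels.hexGraph (↑Λ : Set Literature.Probability.LatticeModels.HexVertex) ((Real.sqrt 3)⁻¹ - m δ * δ)) → ∀ (D D' : Literature.Probability.RandomPlanarGeometry.DobrushinDomain), D.IsHullSubdomain D' → ∀ ε : ℝ, 0 < ε → ∀ θ : ℝ, 0 < θ → ∀ᶠ δ in nhdsWithin 0 (Set.Ioi 0), ∀ (a b : Literature.Probability.LatticeModels.HexVertex) (γ₁ γ₂ : Literature.Probability.RandomPlanarGeometry.SAW.HexDomainSAW D'.carrier δ a b), γ₁.curve ∈ {γ : Literature.Probability.RandomPlanarGeometry.CurveClass ℂ | ∀ z ∈ γ.range,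 ∀ k ∈ closure (D.carrier \ D'.carrier), ε < dist z k} → γ₂.curve ∈ {γ : Literature.Probability.RandomPlanarGeometry.CurveClass ℂ | ∀ z ∈ γ.range, ∀ k ∈ closure (D.carrier \ D'.carrier), ε < dist z k} → Summit.CriticalPhenomena.SAWScalingLimit.Theorems.SAWMassiveIsingTilt.Zloop (Literature.Probability.RandomPlanarGeometry.SAW.hexDomainGraph D.carrier δ) {v | v ∉ γ₁.walk.support} ((Real.sqrt 3)⁻¹ - m δ * δ) * Summit.CriticalPhenomena.SAWScalingLimit.Theorems.SAWMassiveIsingTilt.Zloop (Literature.Probability.RandomPlanarGeometry.SAW.hexDomainGraph D'.carrier δ) {v | v ∉ γ₂.walk.support} ((Real.sqrt 3)⁻¹ - m δ * δ) ≤ (1 + θ) * (Summit.CriticalPhenomena.SAWScalingLimit.Theorems.SAWMassiveIsingTilt.Zloop (Literature.Probability.RandomPlanarGeometry.SAW.hexDomainGraph D'.carrier δ) {v | v ∉ γ₁.walk.support} ((Real.sqrt 3)⁻¹ - m δ * δ) * Summit.CriticalPhenomena.SAWScalingLimit.Theorems.SAWMassiveIsingTilt.Zloop (Literature.Probability.RandomPlanarGeometry.SAW.hexDomainGraph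 D.carrier δ) {v | v ∉ γ₂.walk.support} ((Real.sqrt 3)⁻¹ - m δ * δ))) → ∀ (m x c : ℝ → ℝ), Filter.Tendsto (fun δ => m δ * δ) (nhdsWithin 0 (Set.Ioi 0)) (nhds 0) ∧ Filter.Tendsto (fun δ => m δ / Real.log δ⁻¹) (nhdsWithin 0 (Set.Ioi 0)) Filter.atTop → (Filter.Tendsto (fun δ => c δ / (δ * Real.log δ⁻¹)) (nhdsWithin 0 (Set.Ioi 0)) Filter.atTop ∧ ∀ᶠ δ in nhdsWithin 0 (Set.Ioi 0), ∀ (Λ : Finset Literature.Probability.LatticeModels.HexVertex) (u v : Literature.Probability.LatticeModels.HexVertex), u ∈ Λ → v ∈ Λ → u ≠ v → (∑ᶠ E ∈ {E : Finset (Sym2 Literature.Probability.LatticeModels.HexVertex) | (∀ e ∈ E, e ∈ (Literature.Probability.LatticeModels.hexGraph).edgeSet ∧ ∀ w ∈ e, w ∈ (↑Λ : Set Literature.Probability.LatticeModels.HexVertex)) ∧ ∀ w : Literature.Probability.LatticeModels.HexVertex, (Odd (E.filter (fun e => w ∈ e)).card ↔ (w = u ∨ w = v))}, ((Real.sqrt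 3)⁻¹ - m δ * δ) ^ E.card) ≤ Real.exp (-(c δ * dist (Literature.Probability.LatticeModels.hexCenter u) (Literature.Probability.LatticeModels.hexCenter v))) * Summit.CriticalPhenomena.SAWScalingLimit.Theorems.SAWMassiveIsingTilt.Zloop Literature.Probability.LatticeModels.hexGraph (↑Λ : Set Literature.Probability.LatticeModels.HexVertex) ((Real.sqrt 3)⁻¹ - m δ * δ)) → ∀ (D D' : Literature.Probability.RandomPlanarGeometry.DobrushinDomain), D.IsHullSubdomain D' → ∀ (a b : ℝ → Literature.Probability.LatticeModels.HexVertex), Literature.Probability.RandomPlanarGeometry.SAW.IsEmbEndpointApprox Literature.Probability.LatticeModels.hexGraph Literature.Probability.LatticeModels.hexCenter D a b → Literature.Probability.RandomPlanarGeometry.SAW.IsEmbEndpointApprox Literature.Probability.LatticeModels.hexGraph Literature.Probability.LatticeModels.hexCenter D' a b → ∀ ε : ℝ, 0 < ε → ∀ θ : ℝ, 0 < θ → ∀ᶠ δ in nhdsWithin 0 (Set.Ioi 0), ∃ q : NNReal, ∀ B : Set (Literature.Probability.RandomPlanarGeometry.CurveClass ℂ), MeasurableSet B → (MeasureTheory.Measure.map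 (fun γ : Literature.Probability.RandomPlanarGeometry.SAW.HexDomainSAW D.carrier δ (a δ) (b δ) => γ.curve) (Summit.CriticalPhenomena.SAWScalingLimit.Theorems.SAWMassiveIsingTilt.tiltLaw D.carrier δ (x δ) ((Real.sqrt 3)⁻¹ - m δ * δ) (a δ) (b δ))) (B ∩ {γ : Literature.Probability.RandomPlanarGeometry.CurveClass ℂ | ∀ z ∈ γ.range, ∀ k ∈ closure (D.carrier \ D'.carrier), ε < dist z k}) ≤ ENNReal.ofReal (1 + θ) * (q : ENNReal) * (MeasureTheory.Measure.map (fun γ : Literature.Probability.RandomPlanarGeometry.SAW.HexDomainSAW D'.carrier δ (a δ) (b δ) => γ.curve) (Summit.CriticalPhenomena.SAWScalingLimit.Theorems.SAWMassiveIsingTilt.tiltLaw D'.carrier δ (x δ) ((Real.sqrt 3)⁻¹ - m δ * δ) (a δ) (b δ))) (B ∩ {γ : Literature.Probability.RandomPlanarGeometry.CurveClass ℂ | ∀ z ∈ γ.range, ∀ k ∈ closure (D.carrier \ D'.carrier), ε < dist z k}) ∧ (q : ENNReal) * (MeasureTheory.Measure.map (fun γ : Literature.Probability.RandomPlanarGeometry.SAW.HexDomainSAW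 D'.carrier δ (a δ) (b δ) => γ.curve) (Summit.CriticalPhenomena.SAWScalingLimit.Theorems.SAWMassiveIsingTilt.tiltLaw D'.carrier δ (x δ) ((Real.sqrt 3)⁻¹ - m δ * δ) (a δ) (b δ))) (B ∩ {γ : Literature.Probability.RandomPlanarGeometry.CurveClass ℂ | ∀ z ∈ γ.range, ∀ k ∈ closure (D.carrier \ D'.carrier), ε < dist z k}) ≤ ENNReal.ofReal (1 + θ) * (MeasureTheory.Measure.map (fun γ : Literature.Probability.RandomPlanarGeometry.SAW.HexDomainSAW D.carrier δ (a δ) (b δ) => γ.curve) (Summit.CriticalPhenomena.SAWScalingLimit.Theorems.SAWMassiveIsingTilt.tiltLaw D.carrier δ (x δ) ((Real.sqrt 3)⁻¹ - m δ * δ) (a δ) (b δ))) (B ∩ {γ : Literature.Probability.RandomPlanarGeometry.CurveClass ℂ | ∀ z ∈ γ.range, ∀ k ∈ closure (D.carrier \ D'.carrier), ε < dist z k}) := by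
  intro hN hM m x c hfast hrate D D' hDD' a b ha ha' ε hε θ hθ
  have hpos : (0 : ℝ) < (Real.sqrt 3)⁻¹ := by positivity
  have hy : ∀ᶠ δ in 𝓝[>] (0 : ℝ), 0 ≤ (Real.sqrt 3)⁻¹ - m δ * δ := by
    filter_upwards [hfast.1.eventually_mem (Iio_mem_nhds hpos)] with δ hδ
    exact sub_nonneg.2 (le_of_lt hδ)
  have hK : IsCompact (closure (D.carrier \ D'.carrier)) :=
    Metric.isCompact_of_isClosed_isBounded isClosed_closure
      (D.isBounded.subset fun _ h => h.1).closure
  have hO : MeasurableSet {γ : CurveClass ℂ | ∀ z ∈ γ.range,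
      ∀ k ∈ closure (D.carrier \ D'.carrier), ε < dist z k} :=
    (Summit.CriticalPhenomena.SAWScalingLimit.Theorems.MassiveWindowSLE.Birth.hrd_isOpen_avoid hK ε).measurableSet
  have hev := (hN D D' hDD' a b ha ha' ε hε).and ((hM m c hfast hrate D D' hDD' ε hε θ hθ).and
    (hy.and eventually_mem_nhdsWithin))
  refine hev.mono fun δ ⟨hnest, hmixδ, hyδ, hδ⟩ => ?_
  have hδ0 : δ ≠ 0 := (Set.mem_Ioi.1 hδ).ne'
  haveI := Summit.CriticalPhenomena.SAWScalingLimit.Theorems.ObservableToSLE.Negative.finite_hexDomainSAW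
    D.isBounded hδ0 (a δ) (b δ)
  haveI := Summit.CriticalPhenomena.SAWScalingLimit.Theorems.ObservableToSLE.Negative.finite_hexDomainSAW
    D'.isBounded hδ0 (a δ) (b δ)
  have hZ := Summit.CriticalPhenomena.SAWScalingLimit.Theorems.SAWMassiveIsingTilt.one_le_zloop
    D.isBounded hδ0 hyδ
  have hZ' := Summit.CriticalPhenomena.SAWScalingLimit.Theorems.SAWMassiveIsingTilt.one_le_zloop
    D'.isBounded hδ0 hyδ
  obtain ⟨r₀, hr₀, hmix'⟩ :=
    Summit.CriticalPhenomena.SAWScalingLimit.Theorems.MassiveWindowSLE.Birth.wrm_pinned_of_pairwise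
      {γ : CurveClass ℂ | ∀ z ∈ γ.range, ∀ k ∈ closure (D.carrier \ D'.carrier), ε < dist z k}
      hZ hZ' (hmixδ (a δ) (b δ))
  exact Summit.CriticalPhenomena.SAWScalingLimit.Theorems.MassiveWindowSLE.Birth.wrm_defect_of_ratioMixing
    _ hO hθ.le hZ hZ' hnest.1 hnest.2 hr₀ hmix'

/-- **S1' gives the full window-LSW family along its own schedule.** From the statement of the
registered stub `stub_covariantSimpleRateWindowLimit` (taken verbatim as a hypothesis) — a fast RATE
schedule `m, c`, an eventually positive tilt `x` and ONE window-limit family `P` over all Dobrushin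
domains, conformally covariant and carried by simple curves — the SAME `(m, x, c, P)` is chordal
(`stub_windowLimitChordal`) and has two-sided hull restriction (engine N + F3 + R' ⇒ defect,
`stub_avoidRestrictionOfDefect` ⇒ avoidance form, `stub_hullRestrictionOfAvoidRestriction` ⇒ closed
form). -/
theorem rateWindowLSWFamily_of_covariantSimpleRateWindowLimit :
    (∃ (m x c : ℝ → ℝ) (P : Literature.Probability.RandomPlanarGeometry.ChordalFamily), (Filter.Tendsto (fun δ => m δ * δ) (nhdsWithin 0 (Set.Ioi 0)) (nhds 0) ∧ Filter.Tendsto (fun δ => m δ / Real.log δ⁻¹) (nhdsWithin 0 (Set.Ioi 0)) Filter.atTop ∧ ∀ (D : Literature.Probability.RandomPlanarGeometry.DobrushinDomain) (a b : ℝ → Literature.Probability.LatticeModels.HexVertex), Literature.Probability.RandomPlanarGeometry.SAW.IsEmbEndpointApprox Literature.Probability.LatticeModels.hexGraph Literature.Probability.LatticeModels.hexCenter D a b → Literature.Probability.RandomPlanarGeometry.TendstoLaw (fun δ (γ : Literature.Probability.RandomPlanarGeometry.SAW.HexDomainSAW D.carrier δ (a δ) (b δ)) => γ.curve) (fun δ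 => Summit.CriticalPhenomena.SAWScalingLimit.Theorems.SAWMassiveIsingTilt.tiltLaw D.carrier δ (x δ) ((Real.sqrt 3)⁻¹ - m δ * δ) (a δ) (b δ)) id (P D)) ∧ (Filter.Tendsto (fun δ => c δ / (δ * Real.log δ⁻¹)) (nhdsWithin 0 (Set.Ioi 0)) Filter.atTop ∧ ∀ᶠ δ in nhdsWithin 0 (Set.Ioi 0), ∀ (Λ : Finset Literature.Probability.LatticeModels.HexVertex) (u v : Literature.Probability.LatticeModels.HexVertex), u ∈ Λ → v ∈ Λ → u ≠ v → (∑ᶠ E ∈ {E : Finset (Sym2 Literature.Probability.LatticeModels.HexVertex) | (∀ e ∈ E, e ∈ (Literature.Probability.LatticeModels.hexGraph).edgeSet ∧ ∀ w ∈ e, w ∈ (↑Λ : Set Literature.Probability.LatticeModels.HexVertex)) ∧ ∀ w : Literature.Probability.LatticeModels.HexVertex, (Odd (E.filter (fun e => w ∈ e)).card ↔ (w = u ∨ w = v))}, ((Real.sqrt 3)⁻¹ - m δ * δ) ^ E.card) ≤ Real.exp (-(c δ * dist (Literature.Probability.LatticeModels.hexCenter u) (Literature.Probability.LatticeModels.hexCenter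 v))) * Summit.CriticalPhenomena.SAWScalingLimit.Theorems.SAWMassiveIsingTilt.Zloop Literature.Probability.LatticeModels.hexGraph (↑Λ : Set Literature.Probability.LatticeModels.HexVertex) ((Real.sqrt 3)⁻¹ - m δ * δ)) ∧ (∀ᶠ δ in nhdsWithin 0 (Set.Ioi 0), 0 < x δ) ∧ P.IsConformallyCovariant ∧ P.IsCarriedBySimpleCurves) →
    ∃ (m x c : ℝ → ℝ) (P : Literature.Probability.RandomPlanarGeometry.ChordalFamily), (Filter.Tendsto (fun δ => m δ * δ) (nhdsWithin 0 (Set.Ioi 0)) (nhds 0) ∧ Filter.Tendsto (fun δ => m δ / Real.log δ⁻¹) (nhdsWithin 0 (Set.Ioi 0)) Filter.atTop ∧ ∀ (D : Literature.Probability.RandomPlanarGeometry.DobrushinDomain) (a b : ℝ → Literature.Probability.LatticeModels.HexVertex), Literature.Probability.RandomPlanarGeometry.SAW.IsEmbEndpointApprox Literature.Probability.LatticeModels.hexGraph Literature.Probability.LatticeModels.hexCenter D a b → Literature.Probability.RandomPlanarGeometry.TendstoLaw (fun δ (γ : Literature.Probability.RandomPlanarGeometry.SAW.HexDomainSAW D.carrier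 δ (a δ) (b δ)) => γ.curve) (fun δ => Summit.CriticalPhenomena.SAWScalingLimit.Theorems.SAWMassiveIsingTilt.tiltLaw D.carrier δ (x δ) ((Real.sqrt 3)⁻¹ - m δ * δ) (a δ) (b δ)) id (P D)) ∧ (Filter.Tendsto (fun δ => c δ / (δ * Real.log δ⁻¹)) (nhdsWithin 0 (Set.Ioi 0)) Filter.atTop ∧ ∀ᶠ δ in nhdsWithin 0 (Set.Ioi 0), ∀ (Λ : Finset Literature.Probability.LatticeModels.HexVertex) (u v : Literature.Probability.LatticeModels.HexVertex), u ∈ Λ → v ∈ Λ → u ≠ v → (∑ᶠ E ∈ {E : Finset (Sym2 Literature.Probability.LatticeModels.HexVertex) | (∀ e ∈ E, e ∈ (Literature.Probability.LatticeModels.hexGraph).edgeSet ∧ ∀ w ∈ e, w ∈ (↑Λ : Set Literature.Probability.LatticeModels.HexVertex)) ∧ ∀ w : Literature.Probability.LatticeModels.HexVertex, (Odd (E.filter (fun e => w ∈ e)).card ↔ (w = u ∨ w = v))}, ((Real.sqrt 3)⁻¹ - m δ * δ) ^ E.card) ≤ Real.exp (-(c δ * dist (Literature.Probability.LatticeModels.hexCenter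 u) (Literature.Probability.LatticeModels.hexCenter v))) * Summit.CriticalPhenomena.SAWScalingLimit.Theorems.SAWMassiveIsingTilt.Zloop Literature.Probability.LatticeModels.hexGraph (↑Λ : Set Literature.Probability.LatticeModels.HexVertex) ((Real.sqrt 3)⁻¹ - m δ * δ)) ∧ (∀ᶠ δ in nhdsWithin 0 (Set.Ioi 0), 0 < x δ) ∧ P.IsChordal ∧ P.IsConformallyCovariant ∧ P.IsHullRestriction ∧ P.IsCarriedBySimpleCurves := by
  rintro ⟨m, x, c, P, hW', hrate, hx, hcov, hS⟩
  have hP : P.IsChordal := stub_windowLimitChordal m x P hW'.1 hx hW'.2.2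
  have hdef := windowRestrictionDefect_of_rateMixing stub_windowNesting stub_zloopRateRatioMixing m x c
    ⟨hW'.1, hW'.2.1⟩ hrate
  have havoid := stub_avoidRestrictionOfDefect m x P hW'.2.2 hP hS hdef
  have hres : P.IsHullRestriction := stub_hullRestrictionOfAvoidRestriction P hP hcov havoid hS
  exact ⟨m, x, c, P, hW', hrate, hx, hP, hcov, hres, hS⟩

/-- **The exact size of S1'.** The registered stub `stub_covariantSimpleRateWindowLimit` is
EQUIVALENT to the existence, along some fast RATE schedule with eventually positive tilt, of a
window-limit family with all four LSW axioms (chordal, conformally covariant, hull restriction,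
carried by simple curves): `→` is `rateWindowLSWFamily_of_covariantSimpleRateWindowLimit`, `←` drops
two conjuncts. With `massiveWindowSLE_iff_windowLSWFamily` (the crux ⟺ such a family along SOME
schedule with `m → ∞`, `mδ·δ → 0`) this pins the difference between S1' and the crux to the schedule
class alone. -/
theorem covariantSimpleRateWindowLimit_iff_rateWindowLSWFamily :
    (∃ (m x c : ℝ → ℝ) (P : Literature.Probability.RandomPlanarGeometry.ChordalFamily), (Filter.Tendsto (fun δ => m δ * δ) (nhdsWithin 0 (Set.Ioi 0)) (nhds 0) ∧ Filter.Tendsto (fun δ => m δ / Real.log δ⁻¹) (nhdsWithin 0 (Set.Ioi 0)) Filter.atTop ∧ ∀ (D : Literature.Probability.RandomPlanarGeometry.DobrushinDomain) (a b : ℝ → Literature.Probability.LatticeModels.HexVertex), Literature.Probability.RandomPlanarGeometry.SAW.IsEmbEndpointApprox Literature.Probability.LatticeModels.hexGraph Literature.Probability.LatticeModels.hexCenter D a b → Literature.Probability.RandomPlanarGeometry.TendstoLaw (fun δ (γ : Literature.Probability.RandomPlanarGeometry.SAW.HexDomainSAW D.carrier δ (a δ) (b δ)) => γ.curve) (fun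 δ => Summit.CriticalPhenomena.SAWScalingLimit.Theorems.SAWMassiveIsingTilt.tiltLaw D.carrier δ (x δ) ((Real.sqrt 3)⁻¹ - m δ * δ) (a δ) (b δ)) id (P D)) ∧ (Filter.Tendsto (fun δ => c δ / (δ * Real.log δ⁻¹)) (nhdsWithin 0 (Set.Ioi 0)) Filter.atTop ∧ ∀ᶠ δ in nhdsWithin 0 (Set.Ioi 0), ∀ (Λ : Finset Literature.Probability.LatticeModels.HexVertex) (u v : Literature.Probability.LatticeModels.HexVertex), u ∈ Λ → v ∈ Λ → u ≠ v → (∑ᶠ E ∈ {E : Finset (Sym2 Literature.Probability.LatticeModels.HexVertex) | (∀ e ∈ E, e ∈ (Literature.Probability.LatticeModels.hexGraph).edgeSet ∧ ∀ w ∈ e, w ∈ (↑Λ : Set Literature.Probability.LatticeModels.HexVertex)) ∧ ∀ w : Literature.Probability.LatticeModels.HexVertex, (Odd (E.filter (fun e => w ∈ e)).card ↔ (w = u ∨ w = v))}, ((Real.sqrt 3)⁻¹ - m δ * δ) ^ E.card) ≤ Real.exp (-(c δ * dist (Literature.Probability.LatticeModels.hexCenter u) (Literature.Probability.LatticeModels.hexCenter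 v))) * Summit.CriticalPhenomena.SAWScalingLimit.Theorems.SAWMassiveIsingTilt.Zloop Literature.Probability.LatticeModels.hexGraph (↑Λ : Set Literature.Probability.LatticeModels.HexVertex) ((Real.sqrt 3)⁻¹ - m δ * δ)) ∧ (∀ᶠ δ in nhdsWithin 0 (Set.Ioi 0), 0 < x δ) ∧ P.IsConformallyCovariant ∧ P.IsCarriedBySimpleCurves) ↔
    ∃ (m x c : ℝ → ℝ) (P : Literature.Probability.RandomPlanarGeometry.ChordalFamily), (Filter.Tendsto (fun δ => m δ * δ) (nhdsWithin 0 (Set.Ioi 0)) (nhds 0) ∧ Filter.Tendsto (fun δ => m δ / Real.log δ⁻¹) (nhdsWithin 0 (Set.Ioi 0)) Filter.atTop ∧ ∀ (D : Literature.Probability.RandomPlanarGeometry.DobrushinDomain) (a b : ℝ → Literature.Probability.LatticeModels.HexVertex), Literature.Probability.RandomPlanarGeometry.SAW.IsEmbEndpointApprox Literature.Probability.LatticeModels.hexGraph Literature.Probability.LatticeModels.hexCenter D a b → Literature.Probability.RandomPlanarGeometry.TendstoLaw (fun δ (γ : Literature.Probability.RandomPlanarGeometry.SAW.HexDomainSAW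 D.carrier δ (a δ) (b δ)) => γ.curve) (fun δ => Summit.CriticalPhenomena.SAWScalingLimit.Theorems.SAWMassiveIsingTilt.tiltLaw D.carrier δ (x δ) ((Real.sqrt 3)⁻¹ - m δ * δ) (a δ) (b δ)) id (P D)) ∧ (Filter.Tendsto (fun δ => c δ / (δ * Real.log δ⁻¹)) (nhdsWithin 0 (Set.Ioi 0)) Filter.atTop ∧ ∀ᶠ δ in nhdsWithin 0 (Set.Ioi 0), ∀ (Λ : Finset Literature.Probability.LatticeModels.HexVertex) (u v : Literature.Probability.LatticeModels.HexVertex), u ∈ Λ → v ∈ Λ → u ≠ v → (∑ᶠ E ∈ {E : Finset (Sym2 Literature.Probability.LatticeModels.HexVertex) | (∀ e ∈ E, e ∈ (Literature.Probability.LatticeModels.hexGraph).edgeSet ∧ ∀ w ∈ e, w ∈ (↑Λ : Set Literature.Probability.LatticeModels.HexVertex)) ∧ ∀ w : Literature.Probability.LatticeModels.HexVertex, (Odd (E.filter (fun e => w ∈ e)).card ↔ (w = u ∨ w = v))}, ((Real.sqrt 3)⁻¹ - m δ * δ) ^ E.card) ≤ Real.exp (-(c δ * dist (Literature.Probability.LatticeModels.hexCenter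 u) (Literature.Probability.LatticeModels.hexCenter v))) * Summit.CriticalPhenomena.SAWScalingLimit.Theorems.SAWMassiveIsingTilt.Zloop Literature.Probability.LatticeModels.hexGraph (↑Λ : Set Literature.Probability.LatticeModels.HexVertex) ((Real.sqrt 3)⁻¹ - m δ * δ)) ∧ (∀ᶠ δ in nhdsWithin 0 (Set.Ioi 0), 0 < x δ) ∧ P.IsChordal ∧ P.IsConformallyCovariant ∧ P.IsHullRestriction ∧ P.IsCarriedBySimpleCurves :=
  ⟨rateWindowLSWFamily_of_covariantSimpleRateWindowLimit,
    fun ⟨m, x, c, P, hW', hrate, hx, _, hcov, _, hS⟩ => ⟨m, x, c, P, hW', hrate, hx, hcov, hS⟩⟩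

/-- **The line as one theorem: S1' ⇒ the crux.** The statement of the last open stub of line
`registered` implies `MassiveWindowSLE` BY NAME: the window-LSW family of
`rateWindowLSWFamily_of_covariantSimpleRateWindowLimit`, `m → +∞` from fastness
(`m = (m / log δ⁻¹)·log δ⁻¹`), and the landed LSW 2003 identification
`stub_massiveWindowSLE_of_windowLSWFamily` read back through `massiveWindowSLE_iff`. -/
theorem massiveWindowSLE_of_covariantSimpleRateWindowLimit :
    (∃ (m x c : ℝ → ℝ) (P : Literature.Probability.RandomPlanarGeometry.ChordalFamily), (Filter.Tendsto (fun δ => m δ * δ) (nhdsWithin 0 (Set.Ioi 0)) (nhds 0) ∧ Filter.Tendsto (fun δ => m δ / Real.log δ⁻¹) (nhdsWithin 0 (Set.Ioi 0)) Filter.atTop ∧ ∀ (D : Literature.Probability.RandomPlanarGeometry.DobrushinDomain) (a b : ℝ → Literature.Probability.LatticeModels.HexVertex), Literature.Probability.RandomPlanarGeometry.SAW.IsEmbEndpointApprox Literature.Probability.LatticeModels.hexGraph Literature.Probability.LatticeModels.hexCenter D a b → Literature.Probability.RandomPlanarGeometry.TendstoLaw (fun δ (γ : Literature.Probability.RandomPlanarGeometry.SAW.HexDomainSAW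 D.carrier δ (a δ) (b δ)) => γ.curve) (fun δ => Summit.CriticalPhenomena.SAWScalingLimit.Theorems.SAWMassiveIsingTilt.tiltLaw D.carrier δ (x δ) ((Real.sqrt 3)⁻¹ - m δ * δ) (a δ) (b δ)) id (P D)) ∧ (Filter.Tendsto (fun δ => c δ / (δ * Real.log δ⁻¹)) (nhdsWithin 0 (Set.Ioi 0)) Filter.atTop ∧ ∀ᶠ δ in nhdsWithin 0 (Set.Ioi 0), ∀ (Λ : Finset Literature.Probability.LatticeModels.HexVertex) (u v : Literature.Probability.LatticeModels.HexVertex), u ∈ Λ → v ∈ Λ → u ≠ v → (∑ᶠ E ∈ {E : Finset (Sym2 Literature.Probability.LatticeModels.HexVertex) | (∀ e ∈ E, e ∈ (Literature.Probability.LatticeModels.hexGraph).edgeSet ∧ ∀ w ∈ e, w ∈ (↑Λ : Set Literature.Probability.LatticeModels.HexVertex)) ∧ ∀ w : Literature.Probability.LatticeModels.HexVertex, (Odd (E.filter (fun e => w ∈ e)).card ↔ (w = u ∨ w = v))}, ((Real.sqrt 3)⁻¹ - m δ * δ) ^ E.card) ≤ Real.exp (-(c δ * dist (Literature.Probability.LatticeModels.hexCenter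 u) (Literature.Probability.LatticeModels.hexCenter v))) * Summit.CriticalPhenomena.SAWScalingLimit.Theorems.SAWMassiveIsingTilt.Zloop Literature.Probability.LatticeModels.hexGraph (↑Λ : Set Literature.Probability.LatticeModels.HexVertex) ((Real.sqrt 3)⁻¹ - m δ * δ)) ∧ (∀ᶠ δ in nhdsWithin 0 (Set.Ioi 0), 0 < x δ) ∧ P.IsConformallyCovariant ∧ P.IsCarriedBySimpleCurves) →
    Summit.CriticalPhenomena.SAWScalingLimit.Theses.SAWMassiveIsingTilt.MassiveWindowSLE := by
  intro h
  obtain ⟨m, x, c, P, hW', _, _, hP, hcov, hres, hS⟩ :=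
    rateWindowLSWFamily_of_covariantSimpleRateWindowLimit h
  have hlog : Tendsto (fun δ : ℝ => Real.log δ⁻¹) (𝓝[>] (0 : ℝ)) atTop :=
    Real.tendsto_log_atTop.comp tendsto_inv_nhdsGT_zero
  have hm : Tendsto m (𝓝[>] (0 : ℝ)) atTop := by
    refine (hW'.2.1.atTop_mul_atTop₀ hlog).congr' ?_
    filter_upwards [hlog.eventually_gt_atTop 0] with δ hδ
    exact div_mul_cancel₀ (m δ) hδ.ne'
  exact (Summit.CriticalPhenomena.SAWScalingLimit.Theorems.SAWMassiveIsingTilt.massiveWindowSLE_iff).2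
    (stub_massiveWindowSLE_of_windowLSWFamily ⟨m, x, P, hm, hW'.1, hW'.2.2, hP, hcov, hres, hS⟩)

end Summit.CriticalPhenomena.SAWScalingLimit.Theorems.MassiveWindowSLE.Birth
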